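import Mathlib
import HarnessLib
import Summits.ResolutionOfSingularities.ResolutionOfSingularities.Theorems.WildQuotientsWildQuotientResolutionS1aSymTail

/-!
# S1a — THE QUASI-HOMOGENEOUS ROOT OF THE R4 NORMAL FORM, ring level: centre `e⁻¹(x₀ : w₀, x₁ : w₁, u : w₂)`, shift `sh`, `w₀ = w₁ + sh`

[OURS · L1 W4.5c · lead-1 g16; R4a (`tparab_killsIn_two`, plan-1 RULING R-F15n (2)): «ROOT (x₀:3, x₁:1, u:2; sh 2) — quasi-homogeneous, NOT symmetric,
a(x₀) = sh + max moving weight» and memo X-CERT/R4 §1 (R4 NORMAL FORM `{x₀, u fixed; x₁ ↦ x₁ + x₀; x₃ ↦ x₃ + T(x₁,u)}`) / §7 Correction 1; generalises the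
ring level of ✓`…S1aSymRoot` / ✓`…S1aSymTail` from the weights `(δ+1, 1, 1)` to ARBITRARY weights `w` with `w₀ = w₁ + sh` and to the invariant second
generator] — NOT statements of the manuscript; counted 0; AI-level work, weaker than expert review. Crux stmt-ResolutionOfSingularities-17941
`CyclicQuotientFourfolds`, line `s1a-logminvertex` v13 (`stub_reachLowerInFX`). Pure algebra through `e : A ≃ k[x₀..x₃]`.

Datum (R4 normal form after the linear recoordination `u = x₂ − x₁`, renamed `x₂`): `σ` fixes constants, `x₀` and `x₂`; `σx₁ = x₁ + x₀`; `σx₃ = x₃ + t`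
with the tail `e⁻¹t ∈ 𝒥_sh(e⁻¹(x₀,x₁,x₂); w)`. Centre `f = e⁻¹ ∘ (x₀, x₁, x₂)`, weights `w`, `w 0 = w 1 + sh`; `τ = e⁻¹ σ e`; tail element `t̂ = e⁻¹t·T^sh ∈ R^w`.
* `qh_admissible_one` / `qh_admissible` — (a′)_sh with `β = 1`: `y ∈ 𝒥ₙ ⇒ τy − y ∈ 𝒥ₙ₊sh`; `qh_map_le` (σ-adaptedness);
* `qh_augmentationIdeal_sigmaR_le` — (H1) `augIdeal σ_R ≤ (s^sh)`;
* rows in `R^w`: `qh_sigmaR_u'_zero` (`u₀′` fixed), `qh_sigmaR_u'_one_sub` (`σ_R u₁′ − u₁′ = s^sh·u₀′`), `qh_sigmaR_u'_two` (`u₂′` fixed), `qh_sigmaR_algebraMap_three_sub`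
  (`σ_R x₃ − x₃ = s^sh · t̂`);
* residual: `qh_u'_zero_mem_residual` (`u₀′ ∈ 𝔞 := (augIdeal σ_R : s^sh)`: the `[x₀]`-chart is KILLED), `qh_tail_mem_residual` (`t̂ ∈ 𝔞`), `qh_mem_residual_of_dvd`.
K1′ of the centre is ✓`Sym.sym_isRegular` / ✓`Sym.sym_isRegularRing_quotient` (same generators; weight-free).
-/

set_option linter.dupNamespace false

noncomputable section

open Literature.AlgebraicGeometry.Resolution
open scoped LaurentPolynomial
open MvPolynomial
open Summit.ResolutionOfSingularities.ResolutionOfSingularities.Theorems.WildQuotientResolution.S1.CoarseChart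
open Summit.ResolutionOfSingularities.ResolutionOfSingularities.Theorems.WildQuotientResolution.S1.GameFrame.GModel

namespace Summit.ResolutionOfSingularities.ResolutionOfSingularities.Theorems.WildQuotientResolution.S1.KillCert.Qh

variable {k : Type} [Field k] {A : Type} [CommRing A]
  (σ : MvPolynomial (Fin 4) k ≃+* MvPolynomial (Fin 4) k) (hC : ∀ a : k, σ (C a) = C a)
  (h0 : σ (X 0) = X 0) (h1 : σ (X 1) = X 1 + X 0) (h2 : σ (X 2) = X 2) (w : Fin 3 → ℕ) (sh : ℕ) (t : MvPolynomial (Fin 4) k)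
  (h3 : σ (X 3) = X 3 + t)
  (e : A ≃+* MvPolynomial (Fin 4) k) (τ : A ≃+* A) (hact : ∀ x : A, τ x = e.symm (σ (e x)))
  (hw0 : w 0 = w 1 + sh)
  (ht : e.symm t ∈ (weightedFiltration (e.symm ∘ ![X 0, X 1, X 2] : Fin 3 → A) w).ideal sh)

/-! ## (a′)_sh -/

include hC h0 h1 h2 h3 hact hw0 ht in
/-- **(a′)_sh for the quasi-homogeneous root**, `β = 1` product form: `y ∈ 𝒥ₙ ⇒ τy − y ∈ (1)·𝒥ₙ₊sh` (rows: `x₁ ↦ x₀ ∈ 𝒥_{w₀} = 𝒥_{w₁+sh}`, `x₀, x₂`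
fixed, `x₃ ↦ t ∈ 𝒥_sh`). [OURS · L1 W4.5c · R4 quasi-homogeneous root] -/
theorem qh_admissible_one (n : ℕ) (y : A) (hy : y ∈ (weightedFiltration (e.symm ∘ ![X 0, X 1, X 2] : Fin 3 → A) w).ideal n) :
    τ y - y ∈ Ideal.span {(1 : A)} * (weightedFiltration (e.symm ∘ ![X 0, X 1, X 2] : Fin 3 → A) w).ideal (n + sh) := by
  have hX0 : e.symm (X 0) ∈ (weightedFiltration (e.symm ∘ ![X 0, X 1, X 2] : Fin 3 → A) w).ideal (w 0) :=
    mem_weightedFiltration_ideal (e.symm ∘ ![X 0, X 1, X 2] : Fin 3 → A) w 0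
  have h1J : ∀ {m : ℕ} {z : A}, z ∈ (weightedFiltration (e.symm ∘ ![X 0, X 1, X 2] : Fin 3 → A) w).ideal m →
      z ∈ Ideal.span {(1 : A)} * (weightedFiltration (e.symm ∘ ![X 0, X 1, X 2] : Fin 3 → A) w).ideal m :=
    fun hz => by rw [Ideal.span_singleton_one, Ideal.top_mul]; exact hz
  have hgen : Subring.closure (e.symm '' (Set.range (C : k → MvPolynomial (Fin 4) k) ∪ Set.range (X : Fin 4 → MvPolynomial (Fin 4) k))) = ⊤ := by
    show Subring.closure ((e.symm : MvPolynomial (Fin 4) k →+* A) '' _) = ⊤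
    rw [← RingHom.map_closure, closure_range_C_union_range_X_of k (Fin 4), ← RingHom.range_eq_map]
    exact RingHom.range_eq_top.mpr e.symm.surjective
  refine admissible_shift_of_generators (e.symm ∘ ![X 0, X 1, X 2] : Fin 3 → A) w τ sh 1 _ hgen ?_ ?_ n y hy
  · rintro _ ⟨g, hg | hg, rfl⟩
    · obtain ⟨a, rfl⟩ := hg
      rw [A1.act_symm σ e τ hact, hC, sub_self]; exact Ideal.zero_mem _
    · obtain ⟨i, rfl⟩ := hg
      refine h1J ?_
      fin_cases i
      · rw [Fin.zero_eta, A1.act_symm σ e τ hact, h0, sub_self]; exact Ideal.zero_mem _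
      · rw [Fin.mk_one, A1.act_symm σ e τ hact, h1, map_add, add_sub_cancel_left]
        exact (weightedFiltration _ _).antitone (by omega) hX0
      · change τ (e.symm (X 2)) - e.symm (X 2) ∈ _
        rw [A1.act_symm σ e τ hact, h2, sub_self]; exact Ideal.zero_mem _
      · change τ (e.symm (X 3)) - e.symm (X 3) ∈ _
        rw [A1.act_symm σ e τ hact, h3, map_add, add_sub_cancel_left]
        exact ht
  · intro i
    refine h1J ?_
    fin_cases i
    · change τ (e.symm (X 0)) - e.symm (X 0) ∈ _
      rw [A1.act_symm σ e τ hact, h0, sub_self]; exact Ideal.zero_mem _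
    · change τ (e.symm (X 1)) - e.symm (X 1) ∈ (weightedFiltration (e.symm ∘ ![X 0, X 1, X 2] : Fin 3 → A) w).ideal (w 1 + sh)
      rw [A1.act_symm σ e τ hact, h1, map_add, add_sub_cancel_left, ← hw0]; exact hX0
    · change τ (e.symm (X 2)) - e.symm (X 2) ∈ _
      rw [A1.act_symm σ e τ hact, h2, sub_self]; exact Ideal.zero_mem _

include hC h0 h1 h2 h3 hact hw0 ht in
/-- **(a′)_sh for the quasi-homogeneous root**: `y ∈ 𝒥ₙ ⇒ τy − y ∈ 𝒥ₙ₊sh`. -/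
theorem qh_admissible (n : ℕ) (y : A) (hy : y ∈ (weightedFiltration (e.symm ∘ ![X 0, X 1, X 2] : Fin 3 → A) w).ideal n) :
    τ y - y ∈ (weightedFiltration (e.symm ∘ ![X 0, X 1, X 2] : Fin 3 → A) w).ideal (n + sh) := by
  have h := qh_admissible_one σ hC h0 h1 h2 w sh t h3 e τ hact hw0 ht n y hy
  rwa [Ideal.span_singleton_one, Ideal.top_mul] at h

include hC h0 h1 h2 h3 hact hw0 ht in
/-- σ-adaptedness of the quasi-homogeneous centre, degree by degree. -/
theorem qh_map_le (n : ℕ) : ((weightedFiltration (e.symm ∘ ![X 0, X 1, X 2] : Fin 3 → A) w).ideal n).map (τ : A →+* A) ≤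
    (weightedFiltration (e.symm ∘ ![X 0, X 1, X 2] : Fin 3 → A) w).ideal n :=
  map_le_of_admissible_shift _ _ τ sh 1 (qh_admissible_one σ hC h0 h1 h2 w sh t h3 e τ hact hw0 ht) n

/-! ## (H1), the rows in `R^w` and the residual ideal `𝔞 = (aug σ_R : s^sh)` -/

section Residual

variable {p : ℕ} (hp : 0 < p) (hσp : ∀ x : A, (⇑τ)^[p] x = x)
  (hσJ : ∀ n : ℕ, ((weightedFiltration (e.symm ∘ ![X 0, X 1, X 2] : Fin 3 → A) w).ideal n).map (τ : A →+* A) ≤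
    (weightedFiltration (e.symm ∘ ![X 0, X 1, X 2] : Fin 3 → A) w).ideal n)

include hC h0 h1 h2 h3 hact hw0 ht in
/-- **(H1)**: every increment `σ_R z − z` is a multiple of `s^sh`. [OURS · L1 W4.5c · R4 quasi-homogeneous root] -/
theorem qh_augmentationIdeal_sigmaR_le :
    augmentationIdeal (sigmaR τ (e.symm ∘ ![X 0, X 1, X 2] : Fin 3 → A) w hσJ hp hσp) ≤
      Ideal.span {cobordantAlgebra.s (e.symm ∘ ![X 0, X 1, X 2] : Fin 3 → A) w ^ sh} := by
  have h := augmentationIdeal_sigmaR_le_span_of_admissible_shift (e.symm ∘ ![X 0, X 1, X 2] : Fin 3 → A) w τ hσJ hp hσp sh 1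
    (qh_admissible_one σ hC h0 h1 h2 w sh t h3 e τ hact hw0 ht)
  rwa [map_one, one_mul] at h

include h0 hact in
/-- `σ_R u₀′ = u₀′`. -/
theorem qh_sigmaR_u'_zero :
    sigmaR τ (e.symm ∘ ![X 0, X 1, X 2] : Fin 3 → A) w hσJ hp hσp (cobordantAlgebra.u' _ _ 0) = cobordantAlgebra.u' _ _ 0 := by
  have hu0 : cobordantAlgebra.u' (e.symm ∘ ![X 0, X 1, X 2] : Fin 3 → A) w 0 =
      ⟨LaurentPolynomial.C (e.symm (X 0)) * LaurentPolynomial.T ((w 0 : ℕ) : ℤ), (cobordantAlgebra.u' (e.symm ∘ ![X 0, X 1, X 2] : Fin 3 → A) w 0).2⟩ := rfl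
  rw [hu0, sigmaR_mk]
  exact Subtype.ext (by change LaurentPolynomial.C (τ (e.symm (X 0))) * _ = LaurentPolynomial.C (e.symm (X 0)) * _; rw [A1.act_symm σ e τ hact, h0])

include h2 hact in
/-- `σ_R u₂′ = u₂′` (the invariant generator). -/
theorem qh_sigmaR_u'_two :
    sigmaR τ (e.symm ∘ ![X 0, X 1, X 2] : Fin 3 → A) w hσJ hp hσp (cobordantAlgebra.u' _ _ 2) = cobordantAlgebra.u' _ _ 2 := by
  have hu2 : cobordantAlgebra.u' (e.symm ∘ ![X 0, X 1, X 2] : Fin 3 → A) w 2 =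
      ⟨LaurentPolynomial.C (e.symm (X 2)) * LaurentPolynomial.T ((w 2 : ℕ) : ℤ), (cobordantAlgebra.u' (e.symm ∘ ![X 0, X 1, X 2] : Fin 3 → A) w 2).2⟩ := rfl
  rw [hu2, sigmaR_mk]
  exact Subtype.ext (by change LaurentPolynomial.C (τ (e.symm (X 2))) * _ = LaurentPolynomial.C (e.symm (X 2)) * _; rw [A1.act_symm σ e τ hact, h2])

include h1 hact hw0 in
/-- `σ_R u₁′ − u₁′ = s^sh · u₀′`. -/
theorem qh_sigmaR_u'_one_sub :
    sigmaR τ (e.symm ∘ ![X 0, X 1, X 2] : Fin 3 → A) w hσJ hp hσp (cobordantAlgebra.u' _ _ 1) - cobordantAlgebra.u' _ _ 1 =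
      cobordantAlgebra.s (e.symm ∘ ![X 0, X 1, X 2] : Fin 3 → A) w ^ sh * cobordantAlgebra.u' _ _ 0 := by
  have hyj : τ (e.symm (X 1)) - e.symm (X 1) = 1 * e.symm (X 0) := by rw [A1.act_symm σ e τ hact, h1, map_add]; ring
  have h := sigmaR_sub_eq_of_admissible_shift (e.symm ∘ ![X 0, X 1, X 2] : Fin 3 → A) w τ hσJ hp hσp sh 1 (n := w 1) hyj
    (cobordantAlgebra.u' _ _ 1) (cobordantAlgebra.u' _ _ 0) (by rw [cobordantAlgebra.coe_u']; rfl)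
    (by rw [cobordantAlgebra.coe_u']; change LaurentPolynomial.C (e.symm (X 0)) * LaurentPolynomial.T ((w 0 : ℕ) : ℤ) = _; rw [hw0])
  rw [h, map_one, one_mul]

include h1 hact hw0 in
/-- ★ `u₀′ ∈ 𝔞 := (augIdeal σ_R : s^sh)`: the `[x₀]`-chart is KILLED. -/
theorem qh_u'_zero_mem_residual :
    cobordantAlgebra.u' (e.symm ∘ ![X 0, X 1, X 2] : Fin 3 → A) w 0 ∈
      (augmentationIdeal (sigmaR τ (e.symm ∘ ![X 0, X 1, X 2] : Fin 3 → A) w hσJ hp hσp)).colon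
        (Ideal.span {cobordantAlgebra.s (e.symm ∘ ![X 0, X 1, X 2] : Fin 3 → A) w ^ sh}) := by
  rw [Ideal.mem_colon_span_singleton, mul_comm, ← qh_sigmaR_u'_one_sub σ h1 w sh e τ hact hw0 hp hσp hσJ]
  exact sub_mem_augmentationIdeal _ _

include h3 hact in
/-- `σ_R x₃ − x₃ = s^sh · t̂`, `t̂ = e⁻¹t·T^sh`. -/
theorem qh_sigmaR_algebraMap_three_sub :
    sigmaR τ (e.symm ∘ ![X 0, X 1, X 2] : Fin 3 → A) w hσJ hp hσp (algebraMap A _ (e.symm (X 3))) - algebraMap A _ (e.symm (X 3)) =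
      cobordantAlgebra.s (e.symm ∘ ![X 0, X 1, X 2] : Fin 3 → A) w ^ sh * ⟨_, C_mul_T_mem_cobordantAlgebra _ _ ht⟩ := by
  have hyj : τ (e.symm (X 3)) - e.symm (X 3) = 1 * e.symm t := by rw [A1.act_symm σ e τ hact, h3, map_add]; ring
  have h := sigmaR_sub_eq_of_admissible_shift (e.symm ∘ ![X 0, X 1, X 2] : Fin 3 → A) w τ hσJ hp hσp sh 1 (n := 0) hyj
    (algebraMap A _ (e.symm (X 3))) ⟨_, C_mul_T_mem_cobordantAlgebra _ _ ht⟩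
    (by rw [cobordantAlgebra.coe_algebraMap, Nat.cast_zero, LaurentPolynomial.T_zero, mul_one]) (by rw [Nat.zero_add])
  rw [h, map_one, one_mul]

include h3 hact in
/-- ★ `t̂ ∈ 𝔞 = (aug σ_R : s^sh)`: off the `[x₀]`-chart the residual lies in `V(u₀′) ∩ V(t̂)`. [OURS · L1 W4.5c · R4 quasi-homogeneous root] -/
theorem qh_tail_mem_residual :
    (⟨_, C_mul_T_mem_cobordantAlgebra _ _ ht⟩ : ↥(cobordantAlgebra (e.symm ∘ ![X 0, X 1, X 2] : Fin 3 → A) w)) ∈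
      (augmentationIdeal (sigmaR τ (e.symm ∘ ![X 0, X 1, X 2] : Fin 3 → A) w hσJ hp hσp)).colon
        (Ideal.span {cobordantAlgebra.s (e.symm ∘ ![X 0, X 1, X 2] : Fin 3 → A) w ^ sh}) := by
  rw [Ideal.mem_colon_span_singleton, mul_comm, ← qh_sigmaR_algebraMap_three_sub σ w sh t h3 e τ hact ht hp hσp hσJ]
  exact sub_mem_augmentationIdeal _ _

/-- Any multiple of an element of `𝔞` lies in `𝔞` (used for the norm chart of the tail: `t̂ ∣ N(t̂)^n`). -/
theorem qh_mem_residual_of_dvd {a b : ↥(cobordantAlgebra (e.symm ∘ ![X 0, X 1, X 2] : Fin 3 → A) w)} (hab : a ∣ b)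
    (ha : a ∈ (augmentationIdeal (sigmaR τ (e.symm ∘ ![X 0, X 1, X 2] : Fin 3 → A) w hσJ hp hσp)).colon
      (Ideal.span {cobordantAlgebra.s (e.symm ∘ ![X 0, X 1, X 2] : Fin 3 → A) w ^ sh})) :
    b ∈ (augmentationIdeal (sigmaR τ (e.symm ∘ ![X 0, X 1, X 2] : Fin 3 → A) w hσJ hp hσp)).colon
      (Ideal.span {cobordantAlgebra.s (e.symm ∘ ![X 0, X 1, X 2] : Fin 3 → A) w ^ sh}) :=
  Ideal.mem_of_dvd _ hab ha

end Residual

end Summit.ResolutionOfSingularities.ResolutionOfSingularities.Theorems.WildQuotientResolution.S1.KillCert.Qh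

end
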